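import Mathlib
import Literature.Analysis.OperatorTheory.PseudospectraNormalBauerFike
import Summits.AnomalousDissipation.AnomalousDissipation.Theorems.SoloBlindFloquetBox

/-!
# The monodromy box certificate with Taylor models in the affine parameter `(P⁺)_M`
(solo-blind s80, paper §24.90)

The reduced leaf chain is `q' = (Ã₀(t) + P Ã₁(t)) q` — AFFINE in the pattern parameter `P`.  Its
monodromy is therefore an entire function of `σ = P − P_c` with Taylor coefficients
`M_j = Φ_j(T)` solving the exact block-triangular variational system
`Φ_j' = Ã_c Φ_j + Ã₁ Φ_{j-1}`.  The pilot (kit j337329/j337371) measured that the monodromy moves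
SLOWLY with `P` in an adapted norm (`‖∂_P M‖ ≈ 0.02–0.4`) while every instantaneous (resolvent- or
Lyapunov-level) certificate only reaches boxes of half-width `0.02–0.1`.  The certificate is thus
organised at the MONODROMY level:

* `one_sub_inverse_of_near`, `taylor_box_one_sub_inverse`, `taylor_box_cover` (Banach algebra):
  a certified centre `‖(1 − M₀)⁻¹‖ ≤ C` plus coefficient bounds `‖M_j‖ ≤ a_j (1 ≤ j ≤ d)` and a
  remainder bound `τ` give `‖(1 − M(σ))⁻¹‖ ≤ C/(1 − ηC)` on the whole box, `η = Σ |σ|^j a_j + τ`;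
* `exp_tail_le`, `iterated_duhamel_bound` (real analysis): the remainder — iterated Duhamel
  integrals in a metric where the centre flow is bounded by `G` give `‖Φ_j(t)‖ ≤ G (L t)^j / j!`,
  and `Σ_{j>d} x^j/j! ≤ x^{d+1} e^x/(d+1)!`;
* `two_mul_le_of_sq_le`, `periodic_energy_gain`, `eigenvalue_norm_le_of_quadratic_contraction`
  (the periodic Lyapunov function `W(t)` of the centre): the `L²(0,T)` gain of the periodic
  solution operator, `c ∫|q|² ≤ (2δ)⁻¹ ∫ fᴴ W f`, and the multiplier bound `|μ| ≤ ρ` from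
  `Mᴴ W M ⪯ ρ² W` — the contractive metric in which the Duhamel tail is summed (`G = 1`).
-/

open Finset MeasureTheory Set

namespace Summit.AnomalousDissipation.AnomalousDissipation.Theorems

open Literature.Analysis.OperatorTheory.Pseudospectra

section Algebra

variable {A : Type*} [NormedRing A] [NormedAlgebra ℂ A] [NormOneClass A] [CompleteSpace A]

omit [NormedAlgebra ℂ A] in
/-- **Centre-to-box at `w = 1`.**  If `1 − M₀` is invertible with `‖(1 − M₀)⁻¹‖ ≤ C` and
`‖M − M₀‖ ≤ η` with `ηC < 1`, then `1 − M` is invertible and `‖(1 − M)⁻¹‖ ≤ C/(1 − ηC)`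
[Pseudospectra.norm_inverse_add_le, i.e. TrefethenEmbree2005 Thm 4.1]. -/
theorem one_sub_inverse_of_near {M₀ M : A} {C η : ℝ} (hu : IsUnit (1 - M₀))
    (hC : ‖Ring.inverse (1 - M₀)‖ ≤ C) (hM : ‖M - M₀‖ ≤ η) (hη : η * C < 1) :
    IsUnit (1 - M) ∧ ‖Ring.inverse (1 - M)‖ ≤ C / (1 - η * C) := by
  obtain ⟨u, hu'⟩ := hu
  have hinv : Ring.inverse (1 - M₀) = (↑u⁻¹ : A) := by rw [← hu', Ring.inverse_unit]
  have hu_le : ‖(↑u⁻¹ : A)‖ ≤ C := hinv ▸ hC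
  have he : ‖-(M - M₀)‖ ≤ η := by rw [norm_neg]; exact hM
  have hlt : ‖-(M - M₀)‖ * ‖(↑u⁻¹ : A)‖ < 1 :=
    calc ‖-(M - M₀)‖ * ‖(↑u⁻¹ : A)‖ ≤ η * C :=
          mul_le_mul he hu_le (norm_nonneg _) ((norm_nonneg _).trans he)
      _ < 1 := hη
  obtain ⟨hunit, hbound⟩ := norm_inverse_add_le u (-(M - M₀)) hlt
  have heq : (u : A) + -(M - M₀) = 1 - M := by rw [hu']; abel
  rw [heq] at hunit hbound
  exact ⟨hunit, hbound.trans (div_one_sub_mul_mono (norm_nonneg _) hu_le (norm_nonneg _) he hη)⟩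

omit [NormOneClass A] [CompleteSpace A] in
/-- **Taylor-model deviation.**  If `M = Σ_{j ≤ d} σ^j M_j + R` with `‖R‖ ≤ τ` and
`‖M_j‖ ≤ a_j` for `1 ≤ j ≤ d`, then `‖M − M_0‖ ≤ Σ_{1 ≤ j ≤ d} |σ|^j a_j + τ`. -/
theorem norm_sub_centre_le_of_taylor {M : A} (Mj : ℕ → A) (σ : ℂ) (d : ℕ) (a : ℕ → ℝ) {τ : ℝ}
    (hR : ‖M - ∑ j ∈ range (d + 1), σ ^ j • Mj j‖ ≤ τ)
    (ha : ∀ j, 1 ≤ j → j ≤ d → ‖Mj j‖ ≤ a j) :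
    ‖M - Mj 0‖ ≤ (∑ j ∈ Ico 1 (d + 1), ‖σ‖ ^ j * a j) + τ := by
  have hsplit : ∑ j ∈ range (d + 1), σ ^ j • Mj j = Mj 0 + ∑ j ∈ Ico 1 (d + 1), σ ^ j • Mj j := by
    rw [Finset.range_eq_Ico, Finset.sum_eq_sum_Ico_succ_bot (Nat.succ_pos d), pow_zero, one_smul]
  have hdecomp : M - Mj 0 = (M - ∑ j ∈ range (d + 1), σ ^ j • Mj j) +
      ∑ j ∈ Ico 1 (d + 1), σ ^ j • Mj j := by rw [hsplit]; abel
  have hsum : ‖∑ j ∈ Ico 1 (d + 1), σ ^ j • Mj j‖ ≤ ∑ j ∈ Ico 1 (d + 1), ‖σ‖ ^ j * a j := by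
    refine (norm_sum_le _ _).trans (Finset.sum_le_sum fun j hj => ?_)
    rw [Finset.mem_Ico] at hj
    rw [norm_smul, norm_pow]
    exact mul_le_mul_of_nonneg_left (ha j hj.1 (Nat.lt_succ_iff.mp hj.2)) (pow_nonneg (norm_nonneg _) _)
  rw [hdecomp]
  calc ‖(M - ∑ j ∈ range (d + 1), σ ^ j • Mj j) + ∑ j ∈ Ico 1 (d + 1), σ ^ j • Mj j‖
      ≤ ‖M - ∑ j ∈ range (d + 1), σ ^ j • Mj j‖ + ‖∑ j ∈ Ico 1 (d + 1), σ ^ j • Mj j‖ := norm_add_le _ _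
    _ ≤ τ + ∑ j ∈ Ico 1 (d + 1), ‖σ‖ ^ j * a j := add_le_add hR hsum
    _ = (∑ j ∈ Ico 1 (d + 1), ‖σ‖ ^ j * a j) + τ := add_comm _ _

/-- **The Taylor box.**  Centre certified at `w = 1` (`‖(1 − M_0)⁻¹‖ ≤ C`), validated coefficient
bounds `a_j` and remainder bound `τ` at parameter offset `σ`: if
`η := Σ_{1≤j≤d} |σ|^j a_j + τ` satisfies `ηC < 1` then `1 − M(σ)` is invertible with
`‖(1 − M(σ))⁻¹‖ ≤ C/(1 − ηC)`. -/
theorem taylor_box_one_sub_inverse {M : A} (Mj : ℕ → A) (σ : ℂ) (d : ℕ) (a : ℕ → ℝ) {τ C : ℝ}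
    (hu : IsUnit (1 - Mj 0)) (hC : ‖Ring.inverse (1 - Mj 0)‖ ≤ C)
    (hR : ‖M - ∑ j ∈ range (d + 1), σ ^ j • Mj j‖ ≤ τ)
    (ha : ∀ j, 1 ≤ j → j ≤ d → ‖Mj j‖ ≤ a j)
    (hη : ((∑ j ∈ Ico 1 (d + 1), ‖σ‖ ^ j * a j) + τ) * C < 1) :
    IsUnit (1 - M) ∧
      ‖Ring.inverse (1 - M)‖ ≤ C / (1 - ((∑ j ∈ Ico 1 (d + 1), ‖σ‖ ^ j * a j) + τ) * C) :=
  one_sub_inverse_of_near hu hC (norm_sub_centre_le_of_taylor Mj σ d a hR ha) hη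

omit [NormedAlgebra ℂ A] in
/-- **Finite cover by Taylor boxes.**  If every member `M i` of a family lies in the certified box
of some reference centre `N s` (`1 − N s` invertible, `‖(1 − N s)⁻¹‖ ≤ C s`, `‖M i − N s‖ ≤ η s`,
`η s · C s < 1`), then uniformly `‖(1 − M i)⁻¹‖ ≤ max_s C s/(1 − η s C s)` — the `n`-, leaf- and
wavenumber-free constant the solvability hierarchy consumes. -/
theorem taylor_box_cover {ι S : Type*} [Fintype S] [Nonempty S] (M : ι → A) (N : S → A)
    (C η : S → ℝ) (hN : ∀ s, IsUnit (1 - N s)) (hC : ∀ s, ‖Ring.inverse (1 - N s)‖ ≤ C s)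
    (hη : ∀ s, η s * C s < 1) (cover : ∀ i, ∃ s, ‖M i - N s‖ ≤ η s) (i : ι) :
    IsUnit (1 - M i) ∧
      ‖Ring.inverse (1 - M i)‖ ≤
        Finset.univ.sup' Finset.univ_nonempty (fun s => C s / (1 - η s * C s)) := by
  obtain ⟨s, hs⟩ := cover i
  obtain ⟨hu, hb⟩ := one_sub_inverse_of_near (hN s) (hC s) hs (hη s)
  exact ⟨hu, hb.trans (Finset.le_sup' (fun s => C s / (1 - η s * C s)) (Finset.mem_univ s))⟩

end Algebra

section Remainder

/-- **Exponential tail.**  For `x ≥ 0`: `Σ_{d < j < n} x^j/j! ≤ x^{d+1}/(d+1)! · e^x`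
(from `(d+1)!·i! ≤ (d+1+i)!`). -/
theorem exp_tail_le {x : ℝ} (hx : 0 ≤ x) (d n : ℕ) :
    ∑ j ∈ Ico (d + 1) n, x ^ j / (Nat.factorial j : ℝ) ≤
      x ^ (d + 1) / (Nat.factorial (d + 1) : ℝ) * Real.exp x := by
  rw [Finset.sum_Ico_eq_sum_range]
  have hterm : ∀ i, x ^ (d + 1 + i) / (Nat.factorial (d + 1 + i) : ℝ) ≤
      x ^ (d + 1) / (Nat.factorial (d + 1) : ℝ) * (x ^ i / (Nat.factorial i : ℝ)) := by
    intro i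
    have hdvd := Nat.factorial_mul_factorial_dvd_factorial_add (d + 1) i
    have hle : (Nat.factorial (d + 1) : ℝ) * (Nat.factorial i : ℝ) ≤
        (Nat.factorial (d + 1 + i) : ℝ) := by
      exact_mod_cast Nat.le_of_dvd (Nat.factorial_pos _) hdvd
    rw [pow_add, div_mul_div_comm]
    exact div_le_div_of_nonneg_left (by positivity) (by positivity) hle
  calc ∑ i ∈ range (n - (d + 1)), x ^ (d + 1 + i) / (Nat.factorial (d + 1 + i) : ℝ)
      ≤ ∑ i ∈ range (n - (d + 1)), x ^ (d + 1) / (Nat.factorial (d + 1) : ℝ) *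
          (x ^ i / (Nat.factorial i : ℝ)) := Finset.sum_le_sum fun i _ => hterm i
    _ = x ^ (d + 1) / (Nat.factorial (d + 1) : ℝ) *
          ∑ i ∈ range (n - (d + 1)), x ^ i / (Nat.factorial i : ℝ) := by rw [Finset.mul_sum]
    _ ≤ x ^ (d + 1) / (Nat.factorial (d + 1) : ℝ) * Real.exp x := by
          gcongr
          exact Real.sum_le_exp_of_nonneg hx _

/-- **Iterated Duhamel bound.**  If `g 0 ≤ G` on `[0,T]` and
`g (j+1) t ≤ ∫₀ᵗ L · g j` on `[0,T]` (`L ≥ 0`; in the application `g j t = ‖Φ_j(t)‖` in a metric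
where the centre propagator is bounded by `G` and `L = G · sup‖Ã₁‖`), then
`g j t ≤ G (L t)^j / j!`. -/
theorem iterated_duhamel_bound (g : ℕ → ℝ → ℝ) {G L T : ℝ} (hL : 0 ≤ L)
    (hint : ∀ j, IntervalIntegrable (g j) volume 0 T)
    (h0 : ∀ t ∈ Icc (0 : ℝ) T, g 0 t ≤ G)
    (hstep : ∀ j, ∀ t ∈ Icc (0 : ℝ) T, g (j + 1) t ≤ ∫ s in (0 : ℝ)..t, L * g j s) :
    ∀ j, ∀ t ∈ Icc (0 : ℝ) T, g j t ≤ G * (L * t) ^ j / (Nat.factorial j : ℝ) := by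
  intro j
  induction j with
  | zero => intro t ht; simpa using h0 t ht
  | succ j ih =>
    intro t ht
    have ht0 : 0 ≤ t := ht.1
    have htT : t ≤ T := ht.2
    refine (hstep j t ht).trans ?_
    have hsub : uIcc (0 : ℝ) t ⊆ uIcc (0 : ℝ) T := by
      rw [uIcc_of_le ht0, uIcc_of_le (ht0.trans htT)]; exact Icc_subset_Icc le_rfl htT
    have hgi : IntervalIntegrable (fun s => L * g j s) volume 0 t :=
      ((hint j).mono_set hsub).const_mul L
    have hcont : Continuous fun s : ℝ => L * (G * (L * s) ^ j / (Nat.factorial j : ℝ)) := by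
      fun_prop
    have hbi : IntervalIntegrable (fun s => L * (G * (L * s) ^ j / (Nat.factorial j : ℝ)))
        volume 0 t := hcont.intervalIntegrable 0 t
    calc ∫ s in (0 : ℝ)..t, L * g j s
        ≤ ∫ s in (0 : ℝ)..t, L * (G * (L * s) ^ j / (Nat.factorial j : ℝ)) := by
          apply intervalIntegral.integral_mono_on ht0 hgi hbi
          intro s hs
          exact mul_le_mul_of_nonneg_left (ih s ⟨hs.1, hs.2.trans htT⟩) hL
      _ = G * (L * t) ^ (j + 1) / (Nat.factorial (j + 1) : ℝ) := by
          have hfun : (fun s : ℝ => L * (G * (L * s) ^ j / (Nat.factorial j : ℝ))) =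
              fun s => (L * G * L ^ j / (Nat.factorial j : ℝ)) * s ^ j := by
            funext s; ring
          rw [hfun, intervalIntegral.integral_const_mul, integral_pow]
          have hj : (Nat.factorial j : ℝ) ≠ 0 := by positivity
          have hj1 : ((j : ℝ) + 1) ≠ 0 := by positivity
          rw [Nat.factorial_succ, Nat.cast_mul]
          simp only [ne_eq, Nat.succ_ne_zero, not_false_eq_true, zero_pow, sub_zero, Nat.cast_succ]
          field_simp
          ring

end Remainder

section Lyapunov

/-- **Weighted Young from Cauchy–Schwarz.**  If `x² ≤ wq · wf` (Cauchy–Schwarz for the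
semi-inner product `⟨·, W ·⟩`, `x = Re qᴴ W f`, `wq = qᴴ W q ≥ 0`, `wf = fᴴ W f ≥ 0`) and `δ > 0`,
then `2x ≤ 2δ·wq + wf/(2δ)`. -/
theorem two_mul_le_of_sq_le {x wq wf δ : ℝ} (hx : x ^ 2 ≤ wq * wf) (hwq : 0 ≤ wq)
    (hwf : 0 ≤ wf) (hδ : 0 < δ) : 2 * x ≤ 2 * δ * wq + wf / (2 * δ) := by
  have hb : 0 ≤ 4 * δ ^ 2 * wq + wf := by positivity
  have key : (4 * δ * x) ^ 2 ≤ (4 * δ ^ 2 * wq + wf) ^ 2 := by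
    nlinarith [sq_nonneg (4 * δ ^ 2 * wq - wf), mul_le_mul_of_nonneg_left hx (by positivity : (0:ℝ) ≤ 16 * δ ^ 2)]
  have h4 : 4 * δ * x ≤ 4 * δ ^ 2 * wq + wf := by
    by_contra h
    push Not at h
    nlinarith [h, hb]
  rw [div_eq_mul_inv]
  have hδ2 : 0 < 2 * δ := by positivity
  have : 2 * x = (4 * δ * x) * (2 * δ)⁻¹ := by field_simp; ring
  rw [this]
  have : 2 * δ * wq + wf * (2 * δ)⁻¹ = (4 * δ ^ 2 * wq + wf) * (2 * δ)⁻¹ := by field_simp; ring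
  rw [this]
  exact mul_le_mul_of_nonneg_right h4 (inv_nonneg.mpr hδ2.le)

/-- **`L²` gain of the periodic solution operator from a Lyapunov inequality.**  Along a
`T`-periodic solution of `q' = Ã q + f`, with `V = qᴴ W q` (`W(t) ≻ 0` periodic), the pointwise
certificate `Ẇ + Ãᴴ W + W Ã + 2δ W + c·1 ⪯ 0` gives `V' ≤ −2δ·wq − c·e + 2x`
(`wq = V`, `e = |q|²`, `x = Re qᴴ W f`, `x² ≤ wq · wf` with `wf = fᴴ W f`); periodicity gives
`∫₀ᵀ V' = 0`.  Conclusion: `c ∫₀ᵀ |q|² ≤ (2δ)⁻¹ ∫₀ᵀ fᴴ W f` (hence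
`‖q‖_{L²} ≤ (max‖W‖/(2cδ))^{1/2} ‖f‖_{L²}`). -/
theorem periodic_energy_gain {T c δ : ℝ} (hT : 0 ≤ T) (hδ : 0 < δ) (dV e wq wf x : ℝ → ℝ)
    (hper : ∫ t in (0 : ℝ)..T, dV t = 0)
    (hdV : ∀ t ∈ Icc (0 : ℝ) T, dV t ≤ -2 * δ * wq t - c * e t + 2 * x t)
    (hcs : ∀ t ∈ Icc (0 : ℝ) T, (x t) ^ 2 ≤ wq t * wf t)
    (hwq : ∀ t ∈ Icc (0 : ℝ) T, 0 ≤ wq t) (hwf : ∀ t ∈ Icc (0 : ℝ) T, 0 ≤ wf t)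
    (hi_dV : IntervalIntegrable dV volume 0 T) (hi_e : IntervalIntegrable e volume 0 T)
    (hi_wf : IntervalIntegrable wf volume 0 T) :
    c * ∫ t in (0 : ℝ)..T, e t ≤ 1 / (2 * δ) * ∫ t in (0 : ℝ)..T, wf t := by
  have hpt : ∀ t ∈ Icc (0 : ℝ) T, dV t ≤ -c * e t + 1 / (2 * δ) * wf t := by
    intro t ht
    have hy := two_mul_le_of_sq_le (hcs t ht) (hwq t ht) (hwf t ht) hδ
    have := hdV t ht
    have h2 : wf t / (2 * δ) = 1 / (2 * δ) * wf t := by ring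
    linarith [h2]
  have hi_rhs : IntervalIntegrable (fun t => -c * e t + 1 / (2 * δ) * wf t) volume 0 T :=
    (hi_e.const_mul (-c)).add (hi_wf.const_mul (1 / (2 * δ)))
  have hmono := intervalIntegral.integral_mono_on hT hi_dV hi_rhs hpt
  rw [hper, intervalIntegral.integral_add (hi_e.const_mul (-c)) (hi_wf.const_mul _),
    intervalIntegral.integral_const_mul, intervalIntegral.integral_const_mul] at hmono
  linarith

open Matrix in
/-- **Floquet multipliers from quadratic contraction.**  If `Re (Mx)ᴴ W (Mx) ≤ ρ² · Re xᴴ W x`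
for all `x` (i.e. `Mᴴ W M ⪯ ρ² W`) and `Re vᴴ W v > 0` for `v ≠ 0`, then every eigenvalue `μ`
of `M` satisfies `|μ| ≤ ρ`: the period map is a contraction in the Lyapunov metric `W(0) = W(T)`,
so all multipliers lie in the disk of radius `ρ = e^{−δT}`. -/
theorem eigenvalue_norm_le_of_quadratic_contraction {n : Type*} [Fintype n] [DecidableEq n]
    (M W : Matrix n n ℂ) {ρ : ℝ} (hρ : 0 ≤ ρ)
    (hW : ∀ v : n → ℂ, v ≠ 0 → 0 < (star v ⬝ᵥ W *ᵥ v).re)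
    (hcontr : ∀ x : n → ℂ,
      (star (M *ᵥ x) ⬝ᵥ W *ᵥ (M *ᵥ x)).re ≤ ρ ^ 2 * (star x ⬝ᵥ W *ᵥ x).re)
    {μ : ℂ} {v : n → ℂ} (hv : v ≠ 0) (hMv : M *ᵥ v = μ • v) : ‖μ‖ ≤ ρ := by
  have hq := hcontr v
  rw [hMv, star_smul, smul_dotProduct, mulVec_smul, dotProduct_smul, smul_eq_mul, smul_eq_mul,
    ← mul_assoc] at hq
  have hmm : star μ * μ = ((‖μ‖ ^ 2 : ℝ) : ℂ) := by
    rw [Complex.star_def, Complex.conj_mul', Complex.ofReal_pow]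
  rw [hmm, Complex.re_ofReal_mul] at hq
  have hpos := hW v hv
  by_contra h
  push Not at h
  have h2 : ρ ^ 2 < ‖μ‖ ^ 2 := by
    have := mul_self_lt_mul_self hρ h
    nlinarith [this]
  nlinarith [h2, hpos, hq]

end Lyapunov

end Summit.AnomalousDissipation.AnomalousDissipation.Theorems
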